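import Summits.QuantumFields.YangMills.Theorems.BalabanLadderROTOfKing
import Mathlib.NumberTheory.Niven
import Mathlib.Topology.Instances.AddCircle.DenseSubgroup
import HarnessLib

/-!
# Crux `ROT` (stmt-QuantumFields-20042): ONE Pythagorean angle suffices — the King input reduced to King's single `(3,4,5)` lattice pair

Helper file (`--supports stmt-QuantumFields-20042`) of the fleet lead `ym-spine-20042-p1`, line of record «King split» (skeleton v3
`Cruxes/ROT/Lines/birth.lean`, ff3050db3a1215f0).  The registered `stub_king : KingAll` asks for vanishing finite-angle lattice rotation
defects at EVERY Pythagorean angle (`King.pythagoreanAngles`, a dense subgroup of `ℝ`).  C. King's own theorem (Commun. Math. Phys. 103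
(1986) 323–349, Thm 2.4 and §4) compares the lattice with ONE rotated copy — the `(3,4,5)` lattice pair, angle `θ₀` with `cos θ₀ = 4/5`,
`sin θ₀ = 3/5`, block factor `L = 5` — and then uses that `θ₀/2π` is irrational ((4.10) there) to generate a dense set of rotations.  This
file makes the same reduction in the tree's vocabulary:

* `planeRot_two_pi`, `linActMulti_planeRot_two_pi`, `latticeKingWard_insert_two_pi` — the defect at the angle `2π` is identically `0`, so
  `LatticeKingWard G r a Θ → LatticeKingWard G r a (insert (2π) Θ)` for free;
* `irrational_arcsin_three_fifths_div_two_pi` — `θ₀/(2π) ∉ ℚ` for `θ₀ = arcsin (3/5)` (Mathlib's **Niven theorem** `niven`: a rational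
  multiple of `π` with rational cosine has cosine in `{0, ±1/2, ±1}`, and `cos θ₀ = 4/5`); hence (Mathlib `dense_addSubgroupClosure_pair_iff`)
  `dense_closure_kingAngle_two_pi` — the additive subgroup generated by `θ₀` and `2π` is dense in `ℝ`;
* `latticeRotWard_of_uvCompactAt_of_latticeKingWard_single` — **the King upgrade from ONE angle**: `UVCompactAt r a`, `θ₀/(2π)`
  irrational and `LatticeKingWard G r a {θ₀}` give `LatticeRotWard G r a`;
* `rot_of_kingSingle` / `rot_of_kingSingleLimit` — **the crux from the single-angle King input** in lattice form resp. in the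
  UV-consuming limit-point form (every off-diagonal limit point in `MomentBounds6` units is invariant under `R_{θ₀}` on King's class):
  what a deliverer of the King input has to prove is ONE two-lattice comparison (the `(3,4,5)` pair), for each compact simple `G`, each
  `r`, in hyperscaling units — not one per Pythagorean angle and not in uncalibrated units.

No definition, no named fact, no sorry; standard axioms.  NOT a proof of E1: a reduction of the King input.
-/

set_option autoImplicit false

noncomputable section

open scoped SchwartzMap
open MeasureTheory Filter Topology Real
open Literature.MathematicalPhysics.QuantumFieldTheory Literature.MathematicalPhysics.QuantumLattice
open Literature.MathematicalPhysics.AQFT Literature.Probability.LatticeModels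
open Summit.QuantumFields.YangMills.Cruxes.OSLegsFromFemtoAndGap.DlrCollarTransfer
open Summit.QuantumFields.YangMills.Cruxes.OSLegsAtWeakCouplingC.Sketch
open Summit.QuantumFields.YangMills.Cruxes.OSLegsAtWeakCouplingC.Y2Bridge
open Summit.QuantumFields.YangMills.Theorems.OSLegsFromFemtoAndGap (latticeDist)
open Summit.QuantumFields.YangMills.Theorems.OSLegsFromFemtoAndGap.Upgrade (isOffDiagonal_linActMulti)
open Summit.QuantumFields.YangMills.Theorems.NPointIsotropy.Negative (E4)

namespace Summit.QuantumFields.YangMills.Theorems.ROT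

/-! ## The angle `2π` is free -/

/-- The rotation of the `(x₀,x₁)`-plane by `2π` is the rotation by `0`. [folklore] -/
theorem planeRot_two_pi : planeRot (0 : Fin 3) (2 * π) = planeRot (0 : Fin 3) 0 := by
  refine LinearIsometryEquiv.ext fun x => ?_
  ext j
  fin_cases j <;> simp [planeRot_apply, Real.cos_two_pi, Real.sin_two_pi]

/-- `R_{2π} · F = F` on test functions. [folklore] -/
theorem linActMulti_planeRot_two_pi {n : ℕ} (F : 𝓢((Fin n → E4), ℂ)) :
    linActMulti (planeRot (0 : Fin 3) (2 * π)) F = F := by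
  rw [planeRot_two_pi, GermWard.linActMulti_planeRot_zero]

section KingSingle

variable {G : Type} [Group G] [TopologicalSpace G] [IsTopologicalGroup G] [CompactSpace G]
  [MeasurableSpace G] [BorelSpace G]

/-- **The finite-angle defect at `2π` vanishes identically**, so King's lattice Ward statement on `Θ` gives it on
`insert (2π) Θ` with the same germ radius. [folklore] -/
theorem latticeKingWard_insert_two_pi (r : LatticeRep G) (a : ℝ → ℝ) {Θ : Set ℝ} (hK : LatticeKingWard G r a Θ) :
    LatticeKingWard G r a (insert (2 * π) Θ) := by
  intro sch hunits hβ hranges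
  obtain ⟨r₀, hr₀, hKs⟩ := hK sch hunits hβ hranges
  refine ⟨r₀, hr₀, fun n hn F hF θ hθ => ?_⟩
  rcases Set.mem_insert_iff.1 hθ with rfl | hθ'
  · simp only [linActMulti_planeRot_two_pi, sub_self]
    exact tendsto_const_nhds
  · exact hKs n hn F hF θ hθ'

end KingSingle

/-! ## King's angle: `θ₀ = arcsin (3/5)`, `θ₀ / 2π ∉ ℚ` (Niven) -/

/-- `cos (arcsin (3/5)) = 4/5` — the `(3,4,5)` triangle. [folklore] -/
theorem cos_arcsin_three_fifths : Real.cos (Real.arcsin (3 / 5)) = 4 / 5 := by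
  rw [Real.cos_arcsin]
  rw [show (1 : ℝ) - (3 / 5) ^ 2 = (4 / 5) ^ 2 by norm_num]
  exact Real.sqrt_sq (by norm_num)

/-- **King's angle is an irrational multiple of `2π`**: `arcsin (3/5) / (2π) ∉ ℚ` — by Niven's theorem (Mathlib `niven`): a rational
multiple of `π` with rational cosine has cosine in `{−1, −1/2, 0, 1/2, 1}`, while `cos θ₀ = 4/5`.  (C. King, CMP 103 (1986), (4.10)
proves the same by hand.) [I. Niven, *Irrational Numbers* (1956), Cor. 3.12] -/
theorem irrational_arcsin_three_fifths_div_two_pi : Irrational (Real.arcsin (3 / 5) / (2 * π)) := by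
  rintro ⟨q, hq⟩
  have hθ : ∃ r : ℚ, Real.arcsin (3 / 5) = r * π := by
    refine ⟨2 * q, ?_⟩
    have hπ : (π : ℝ) ≠ 0 := Real.pi_ne_zero
    push_cast
    rw [hq]
    field_simp
  have hcos : ∃ q' : ℚ, Real.cos (Real.arcsin (3 / 5)) = q' := ⟨4 / 5, by rw [cos_arcsin_three_fifths]; push_cast; ring⟩
  have h := niven hθ hcos
  rw [cos_arcsin_three_fifths] at h
  simp only [Set.mem_insert_iff, Set.mem_singleton_iff] at h
  norm_num at h

/-- The additive subgroup of `ℝ` generated by King's angle `arcsin (3/5)` and `2π` is dense (Mathlib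
`dense_addSubgroupClosure_pair_iff`: density ⇔ irrationality of the ratio). [folklore] -/
theorem dense_closure_kingAngle_two_pi :
    Dense ((AddSubgroup.closure ({Real.arcsin (3 / 5), 2 * π} : Set ℝ) : AddSubgroup ℝ) : Set ℝ) :=
  dense_addSubgroupClosure_pair_iff.2 irrational_arcsin_three_fifths_div_two_pi

section Upgrade

variable {G : Type} [Group G] [TopologicalSpace G] [IsTopologicalGroup G] [CompactSpace G]
  [MeasurableSpace G] [BorelSpace G]

/-- **The King upgrade from ONE angle**: UV sequential compactness off the diagonal plus vanishing finite-angle lattice rotation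
defects at a SINGLE angle `θ₀` with `θ₀/(2π)` irrational give the infinitesimal lattice rotation-Ward identity along every admissible
scheme — the defect at `2π` is free, and `ℤθ₀ + 2πℤ` is dense in `ℝ`. [C. King, CMP 103 (1986) Thm 2.4 and (4.10) — mechanism] -/
theorem latticeRotWard_of_uvCompactAt_of_latticeKingWard_single (r : LatticeRep G) (a : ℝ → ℝ) (hX : UVCompactAt r a)
    {θ₀ : ℝ} (hθ : Irrational (θ₀ / (2 * π))) (hK : LatticeKingWard G r a {θ₀}) : LatticeRotWard G r a := by
  have hpair : LatticeKingWard G r a ({2 * π, θ₀} : Set ℝ) := latticeKingWard_insert_two_pi r a hK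
  refine latticeRotWard_of_uvCompactAt_of_latticeKingWard r a hX _ ?_ hpair
  rw [Set.pair_comm]
  exact dense_addSubgroupClosure_pair_iff.2 hθ

end Upgrade

/-! ## The crux from the single-angle King input -/

/-- **`ROT` from the single-angle King input, lattice form**: if for every compact simple `G`, every `r` and every positive unit map
`a → 0` carrying `MomentBounds6 G r a` the finite-angle lattice rotation defects vanish at King's angle `θ₀ = arcsin (3/5)` alone
(`LatticeKingWard G r a {θ₀}`: ONE two-lattice comparison, the `(3,4,5)` pair), then `Theses.BalabanLadder.ROT` holds.  The
`LowerBounds` guard of `ROT` is not used. [C. King, CMP 103 (1986) Thm 2.4 — mechanism] -/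
theorem rot_of_kingSingle
    (hK : ∀ (G : Type) [Group G] [TopologicalSpace G] [IsTopologicalGroup G] [CompactSpace G],
      IsCompactSimpleLieGroup G → letI : MeasurableSpace G := borel G; haveI : BorelSpace G := ⟨rfl⟩;
      ∀ (r : LatticeRep G) (a : ℝ → ℝ), (∀ β, 0 < a β) → Tendsto a atTop (𝓝 0) → MomentBounds6 G r a →
        LatticeKingWard G r a ({Real.arcsin (3 / 5)} : Set ℝ)) :
    Summit.QuantumFields.YangMills.Theses.BalabanLadder.ROT := by
  intro G _ _ _ _ hG
  letI : MeasurableSpace G := borel G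
  haveI : BorelSpace G := ⟨rfl⟩
  intro r a ha ha0 _ hUV
  exact latticeRotWard_of_uvCompactAt_of_latticeKingWard_single r a (stub_uvExtract G hG r a ha ha0 hUV)
    irrational_arcsin_three_fifths_div_two_pi (hK G hG r a ha ha0 hUV)

/-- **`ROT` from the single-angle King input, limit-point form** (UV-consuming): if for every compact simple `G`, every `r` and every
positive unit map `a → 0` carrying `MomentBounds6 G r a`, every off-diagonal limit point along every subsequence of every admissible
scheme is invariant under the ONE rotation `R_{θ₀}`, `θ₀ = arcsin (3/5)`, on King's class (`r₀` per scheme), then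
`Theses.BalabanLadder.ROT` holds — `stub_uvExtract` (compactness), `latticeKingWard_of_uvCompactAt_of_limitsKingInvariant`, and the
single-angle upgrade. [C. King, CMP 103 (1986) Thm 2.4 — mechanism] -/
theorem rot_of_kingSingleLimit
    (hKL : ∀ (G : Type) [Group G] [TopologicalSpace G] [IsTopologicalGroup G] [CompactSpace G],
      IsCompactSimpleLieGroup G → letI : MeasurableSpace G := borel G; haveI : BorelSpace G := ⟨rfl⟩;
      ∀ (r : LatticeRep G) (a : ℝ → ℝ), (∀ β, 0 < a β) → Tendsto a atTop (𝓝 0) → MomentBounds6 G r a →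
        ∀ sch : SpeciesScheme (YMSpecies G), IsLegScheme a sch → ∃ r₀ : ℝ, 0 < r₀ ∧
          ∀ φ : ℕ → ℕ, Tendsto φ atTop atTop → ∀ S₁ : SchwingerFamily E4, OffDiagLimitAlong r sch φ S₁ →
            ∀ (n : ℕ), 2 ≤ n → ∀ F ∈ King.KingClass n r₀,
              S₁ n (linActMulti (planeRot (0 : Fin 3) (Real.arcsin (3 / 5))) F) = S₁ n F) :
    Summit.QuantumFields.YangMills.Theses.BalabanLadder.ROT := by
  intro G _ _ _ _ hG
  letI : MeasurableSpace G := borel G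
  haveI : BorelSpace G := ⟨rfl⟩
  intro r a ha ha0 _ hUV
  have hX : UVCompactAt r a := stub_uvExtract G hG r a ha ha0 hUV
  refine latticeRotWard_of_uvCompactAt_of_latticeKingWard_single r a hX irrational_arcsin_three_fifths_div_two_pi
    (latticeKingWard_of_uvCompactAt_of_limitsKingInvariant r a hX _ fun sch hsch => ?_)
  obtain ⟨r₀, hr₀, H⟩ := hKL G hG r a ha ha0 hUV sch hsch
  exact ⟨r₀, hr₀, fun φ hφ S₁ hS₁ n hn F hF θ hθ => by
    rw [Set.mem_singleton_iff.1 hθ]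
    exact H φ hφ S₁ hS₁ n hn F hF⟩

/-! ## The King form is lossless (appended 2026-08-26): `ROT ⇒` invariance of the UV limit points `⇒ KING`, under UV compactness

The converse of the King upgrade.  If the infinitesimal rotation-Ward defect vanishes along a scheme (`LatticeRotWard G r a`),
every off-diagonal limit point `S₁` along every subsequence annihilates the generator derivatives on the germ, so its orbit
functions are constant (tree `GermWard.orbit_eq_of_ward`: bounded densities ⇒ differentiable orbits with derivative `S₁ n D = 0`):
`S₁` is invariant under EVERY rotation of the `(x₀,x₁)`-plane on King's class; with `UVCompactAt r a` this gives the finite-angle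
lattice statement `LatticeKingWard G r a Θ` for every angle set `Θ`.  Hence, in units carrying `MomentBounds6` (compactness by the
proved `stub_uvExtract`), **King's single-angle lattice Ward statement and the crux's conclusion `LatticeRotWard` are EQUIVALENT**
(`latticeKingWard_single_iff_latticeRotWard_of_momentBounds6`): the King split of `ROT` has been consumed down to the crux's own
open content, now in the finite form (ONE two-lattice comparison) that a Bałaban-type two-orientation effective-action comparison
would deliver. -/

section Lossless

variable {G : Type} [Group G] [TopologicalSpace G] [IsTopologicalGroup G] [CompactSpace G]
  [MeasurableSpace G] [BorelSpace G]

/-- **`ROT` along the scheme ⇒ every off-diagonal limit point is invariant under EVERY rotation of the `(x₀,x₁)`-plane on King's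
class** (no compactness needed): the limit point satisfies the rotation Ward identity on the germ (`S₁ n D = lim T_{φ j} D = 0`),
and a density-bounded functional with the Ward identity has constant orbit functions (`GermWard.orbit_eq_of_ward`). [folklore] -/
theorem limitsInvariant_of_latticeRotWard (r : LatticeRep G) (a : ℝ → ℝ) (hR : LatticeRotWard G r a)
    (sch : SpeciesScheme (YMSpecies G)) (hsch : IsLegScheme a sch) :
    ∃ r₀ : ℝ, 0 < r₀ ∧ ∀ φ : ℕ → ℕ, Tendsto φ atTop atTop → ∀ S₁ : SchwingerFamily E4,
      OffDiagLimitAlong r sch φ S₁ → ∀ (n : ℕ), 2 ≤ n → ∀ F ∈ King.KingClass n r₀, ∀ θ : ℝ,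
        S₁ n (linActMulti (planeRot (0 : Fin 3) θ) F) = S₁ n F := by
  obtain ⟨hunits, hβ, hranges⟩ := hsch
  obtain ⟨r₀, hr₀, hRs⟩ := hR sch hunits hβ hranges
  refine ⟨r₀, hr₀, fun φ hφ S₁ hS₁ n hn F hF θ => ?_⟩
  obtain ⟨-, hdens, hconv⟩ := hS₁
  obtain ⟨hFo, hFc, ⟨δ, hδ, hFδ⟩, hFr⟩ := hF
  refine GermWard.orbit_eq_of_ward S₁ hdens (fun F' D hF'o hF'c hF'δ hF'r hD => ?_) F hFo hFc hδ hFδ hFr θ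
  -- the Ward identity of the limit point: `S₁ n D = lim_j T_{φ j} D = 0`
  obtain ⟨δ', hδ', hF'δ'⟩ := hF'δ
  have hDoff : IsOffDiagonal D :=
    GermWard.isOffDiagonal_of_tsupport_subset_separated hδ' ((tsupport_rotDeriv_subset F' D hD).trans hF'δ')
  have h0 := (hRs n hn F' D hF'o hF'c ⟨δ', hδ', hF'δ'⟩ hF'r hD).comp hφ
  exact tendsto_nhds_unique (hconv n hn D hDoff) h0

/-- **Under UV compactness, `ROT ⇒ KING` for every angle set** (the converse of the King upgrade). [folklore] -/
theorem latticeKingWard_of_uvCompactAt_of_latticeRotWard (r : LatticeRep G) (a : ℝ → ℝ) (hX : UVCompactAt r a)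
    (hR : LatticeRotWard G r a) (Θ : Set ℝ) : LatticeKingWard G r a Θ :=
  latticeKingWard_of_uvCompactAt_of_limitsKingInvariant r a hX Θ fun sch hsch => by
    obtain ⟨r₀, hr₀, H⟩ := limitsInvariant_of_latticeRotWard r a hR sch hsch
    exact ⟨r₀, hr₀, fun φ hφ S₁ hS₁ n hn F hF θ _ => H φ hφ S₁ hS₁ n hn F hF θ⟩

/-- **Under UV compactness, KING at ONE angle `θ₀` with `θ₀/(2π)` irrational ⇔ `ROT`.** [C. King, CMP 103 (1986) Thm 2.4 —
mechanism; folklore converse] -/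
theorem latticeKingWard_single_iff_latticeRotWard (r : LatticeRep G) (a : ℝ → ℝ) (hX : UVCompactAt r a) {θ₀ : ℝ}
    (hθ : Irrational (θ₀ / (2 * π))) : LatticeKingWard G r a {θ₀} ↔ LatticeRotWard G r a :=
  ⟨latticeRotWard_of_uvCompactAt_of_latticeKingWard_single r a hX hθ,
    fun hR => latticeKingWard_of_uvCompactAt_of_latticeRotWard r a hX hR _⟩

/-- **Under UV compactness, KING on any angle set with dense additive closure ⇔ `ROT`.** [C. King, CMP 103 (1986) Thm 2.4 —
mechanism; folklore converse] -/
theorem latticeKingWard_iff_latticeRotWard (r : LatticeRep G) (a : ℝ → ℝ) (hX : UVCompactAt r a) (Θ : Set ℝ)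
    (hΘ : Dense ((AddSubgroup.closure Θ : AddSubgroup ℝ) : Set ℝ)) : LatticeKingWard G r a Θ ↔ LatticeRotWard G r a :=
  ⟨latticeRotWard_of_uvCompactAt_of_latticeKingWard r a hX Θ hΘ,
    fun hR => latticeKingWard_of_uvCompactAt_of_latticeRotWard r a hX hR Θ⟩

end Lossless

/-- **The King split is lossless at the crux's own hypotheses**: for a compact simple `G`, any `r`, any positive unit map `a → 0`
carrying `MomentBounds6 G r a`, King's single-angle lattice Ward statement at `θ₀ = arcsin (3/5)` (ONE two-lattice comparison, the
`(3,4,5)` pair) is EQUIVALENT to the crux's conclusion `LatticeRotWard G r a` — compactness from the proved `stub_uvExtract`,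
`⇒` by the single-angle King upgrade, `⇐` by `GermWard.orbit_eq_of_ward` on the limit points.  So after `stub_uvExtract` the line's
remaining King input, in its sharpest form, is exactly `ROT`'s open content (the `LowerBounds` guard of `ROT` being idle).
[C. King, CMP 103 (1986) Thm 2.4 — mechanism] -/
theorem latticeKingWard_single_iff_latticeRotWard_of_momentBounds6
    (G : Type) [Group G] [TopologicalSpace G] [IsTopologicalGroup G] [CompactSpace G] (hG : IsCompactSimpleLieGroup G) :
    letI : MeasurableSpace G := borel G; haveI : BorelSpace G := ⟨rfl⟩;
    ∀ (r : LatticeRep G) (a : ℝ → ℝ), (∀ β, 0 < a β) → Tendsto a atTop (𝓝 0) → MomentBounds6 G r a →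
      (LatticeKingWard G r a ({Real.arcsin (3 / 5)} : Set ℝ) ↔ LatticeRotWard G r a) := by
  letI : MeasurableSpace G := borel G
  haveI : BorelSpace G := ⟨rfl⟩
  intro r a ha ha0 hMB
  exact latticeKingWard_single_iff_latticeRotWard r a (stub_uvExtract G hG r a ha ha0 hMB)
    irrational_arcsin_three_fifths_div_two_pi

end Summit.QuantumFields.YangMills.Theorems.ROT

end
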